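import Literature.NumberTheory.EllipticCurves.KuriharaNumberKimStructure
import Literature.NumberTheory.EllipticCurves.BSDSelmerPConverse
import Literature.NumberTheory.EllipticCurves.BSDSelmerParityDokchitserBaseChangeProofs
import Literature.NumberTheory.EllipticCurves.BSDSelmerPConverseCommonLeavesProofs
import Literature.NumberTheory.EllipticCurves.NonvanishingTwistsWaldspurgerOfHoffsteinLuo
import Literature.NumberTheory.EllipticCurves.HeegnerPointsKolyvaginTorsionProofs
import Literature.NumberTheory.EllipticCurves.NonEisensteinPrimeOfSurjective
import Literature.NumberTheory.EllipticCurves.BSDRootNumberNoContinuationProofs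
import HarnessLib

/-!
# The corank-one `p`-converse without ramification hypothesis (Yan–Zhu, Cor. 1.4): proof architecture

Family `bsd`, topic `NumberTheory/EllipticCurves`; companion to
`Literature.NumberTheory.EllipticCurves.KuriharaNumberKimStructure`, which holds the named fact
`yanZhu_analyticRank_eq_one_of_selmerCorank_eq_one` (X. Yan, X. Zhu, *Main conjectures for
non-CM elliptic curves at good ordinary primes*, arXiv:2412.20078 = J. Algebra (2026),
**Cor. 1.4** = Thm. 4.15, (2) ⇒ (3) for `r = 1`: for `E/ℚ` with globally minimal model `W`, a prime
`p ≥ 5` of good ordinary reduction with `ρ̄_{E,p}` surjective,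
`corank_{ℤ_p} Sel_{p^∞}(E/ℚ) = 1 ⟹ ord_{s=1} L(E, s) = 1` — no hypothesis (ram), unlike the
tree's `burungaleSkinnerTianWan_analyticRank_eq_one_of_selmerCorank_eq_one`), and to
`BSDSelmerPConverse` / `BSDSelmerPConverseProofs`, which do the same service for
Burungale–Skinner–Tian–Wan, Thm. 1.10.

## The printed proof (held text `paper:arxiv-2412.20078`, chunk 12 of 14, §4.6, proof of Thm. 4.15)

"(1) ⇒ (2) is trivial. (3) ⇒ (1) is given by Gross-Zagier ([GZ]) and Kolyvagin ([Kol]). For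
(2) ⇒ (3), we can choose an imaginary quadratic field `K` such that `ord_{s=1} L(E^K, s) ≤ 1` and
`(E, K)` satisfies the Heegner hypothesis by [FH]. Similarly to [Wan], by applying descent
arguments to (the rational part of) Theorem 4.12 (2) and using Gross-Zagier formula, we have
`corank_{ℤ_p} Sel_{p^∞}(E/K) = 1` implies `ord_{s=1} L(E/K, s) = 1`, therefore we have (2) ⇒ (3)
holds." Here Thm. 4.12 (2) is the (rational) Heegner point main conjecture over `K` under the
standing hypotheses of §4.5 (chunk 11): "`p > 2` a prime such that `E` has good ordinary
reduction at `p`, `K` an imaginary quadratic field such that `p = 𝔭𝔭̄` split in `K` and `(E, K)`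
satisfies the Heegner hypothesis. Assume that residue representation `ρ̄_E|_{G_K}` […] is
irreducible."

So the architecture is that of Burungale–Skinner–Tian–Wan, arXiv:2409.01350v2, proof of Thm. 12.3
(Part II, §12.1.2; transcribed in `analyticRank_eq_one_of_selmerCorank_eq_one_of_padicSurjective`), with
the `K`-level `p`-converse no longer requiring (ram):

* (a) parity: `corank_{ℤ_p} Sel_{p^∞}(E/ℚ) = 1 ⇒ w(E) = -1` (tree fact `p_parity`,
  Dokchitser–Dokchitser 2010, Thm. 1.4), so that a Heegner field `K` has `w(E^{(d_K)}) = +1` and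
  Yan–Zhu's "`ord_{s=1} L(E^K, s) ≤ 1`" means `L(E^{(d_K)}, 1) ≠ 0`;
* (b) "[FH]": an imaginary quadratic `K` with the Heegner hypothesis for `N`, `p` split in `K`
  (§4.5) and `L(E^{(d_K)}, 1) ≠ 0` (tree fact
  `friedbergHoffstein_exists_heegnerField_split_twist_ne_zero`, Friedberg–Hoffstein 1995);
* (c) Kato: `L(E^{(d_K)}, 1) ≠ 0 ⇒ Sel_{p^∞}(E^{(d_K)}/ℚ)` finite (tree fact
  `kato_finite_of_L_one_ne_zero`, Kato 2004, Thm. 14.2), so that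
* (d) `corank_{ℤ_p} Sel_{p^∞}(E/K) = corank Sel_{p^∞}(E/ℚ) + corank Sel_{p^∞}(E^{(d_K)}/ℚ) = 1 + 0`
  (tree THEOREM `selmerCorank_baseChange_quadratic_holds`, Dokchitser–Dokchitser 2010, Lemma 4.14);
* (e') the `p`-converse over `K` WITHOUT (ram): `corank_{ℤ_p} Sel_{p^∞}(E/K) = 1 ⟹
  ord_{s=1} L(E/K, s) = 1` for `p` good ordinary, `p` split in `K`, Heegner hypothesis,
  `ρ̄_E|_{G_K}` irreducible (the display above; also Burungale–Castella–Grossi–Skinner, Camb. J.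
  Math. 14 (2026) = arXiv:2312.09301, Cor. 1, rank-one case, p. 4 of the held text: "In the rank
  one case it yields a `p`-converse to the Gross–Zagier and Kolyvagin theorem:
  `corank_{ℤ_p} Sel_{p^∞}(E/K) = 1 ⟹ ord_{s=1} L(E/K, s) = 1`", for `(E, p, K)` as in their
  Thm. 1: `p` odd good ordinary split in `K`, (Heeg), (disc), (tor), and the rational
  anticyclotomic main conjecture, known for `p > 3` under (irr)) — the one deep input, carried
  here as the explicit hypothesis `hL` in the special case the assembly consumes (`p > 3`,
  `ρ̄_{E,p} : G_ℚ → GL₂(𝔽_p)` surjective, which for `p ≥ 3` makes `ρ̄_E|_{G_K}` absolutely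
  irreducible — the image of `G_K` has index `≤ 2`, hence contains `SL₂(𝔽_p)` — and gives (tor)
  `E(K)[p] = 0`);
* (f) `ord_{s=1} L(E/K, s) = ord_{s=1} L(E, s) + ord_{s=1} L(E^{(d_K)}, s) = ord L(E) + 0`
  ("using Gross-Zagier formula" / Artin formalism; tree theorem `analyticRankEK_eq_add_of` from
  modularity `hasEntireLFunction_rat`, and `analyticRank_eq_zero_of_entireLFunction_one_ne_zero`).

## Contents

* `yanZhu_analyticRank_eq_one_of_selmerCorank_eq_one_of_leaves` — the named fact PROVED from
  (a), (b), (c), (e'), (f) ((d) being a tree theorem), with (e') spelled out inline.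
* `analyticRank_eq_one_of_selmerCorank_eq_one_of_yanZhu`,
  `burungaleSkinnerTianWan_analyticRank_eq_one_of_selmerCorank_eq_one_of_yanZhu_of_five_le` — the
  interim bsd.S25 statement, resp. the `p ≥ 5` part of the transcription of BSTW Thm. 1.10, are
  formal consequences of the Yan–Zhu fact (drop (ram) / `hloc`).
* `yanZhu_analyticRank_eq_one_of_selmerCorank_eq_one_of_rootNumber_eq_neg_one` (the descent from
  the sign `w(E) = -1` onwards, explicit binders) and
  `yanZhu_analyticRank_eq_one_of_selmerCorank_eq_one_of_exists_isNewformOf` — the fact over the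
  COMMON LEAF SET of the bsd.S19/S20/S25 cluster (`BSDSelmerPConverseCommonLeavesProofs`): the
  Modularity Theorem `ModularForms.exists_isNewformOf`, Waldspurger, Murty–Murty (Remark 1),
  Gross–Zagier–Kolyvagin `rank_eq_analyticRank_of_analyticRank_le_one`,
  `dokchitser_selmerCorank_baseChange_mod_two_eq`, Friedberg–Hoffstein, and (e') inline — on which
  the tree's reductions of (a) `p_parity` (odd `p`), (c) `kato_finite_of_L_one_ne_zero` and (f)
  `hasEntireLFunction_rat` already rest.
* `exists_heegnerField_split_twist_ne_zero_discr_emod_eight_of_hoffsteinLuo` and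
  `yanZhu_analyticRank_eq_one_of_selmerCorank_eq_one_of_bcgs_of_rootNumber_eq_neg_one`,
  `…_of_bcgs`, `…_of_bcgs_of_exists_isNewformOf` — a SECOND decomposition, through the library's
  reduction of Friedberg–Hoffstein to Hoffstein–Luo 1997
  (`NonvanishingTwistsWaldspurgerOfHoffsteinLuo`): Hoffstein–Luo's discriminant is `≡ 1 (mod 8)`,
  so the auxiliary field also satisfies Burungale–Castella–Grossi–Skinner's hypothesis (disc)
  (`d_K` odd, `≠ -3`), and (tor) `E(K)[p] = 0`, (irr) follow from the surjectivity of `ρ̄_{E,p}`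
  (tree theorems); the `K`-level leaf can therefore be taken to be **BCGS, Thm. 1 with Cor. 1
  (rank-one case) exactly as printed** (`p > 3` good ordinary, (irr), (Heeg), (disc), (tor), `p`
  split), inline as `hBCGS`, instead of Yan–Zhu's §4.6 display — and the analytic leaves become
  the Modularity Theorem and Hoffstein–Luo.
* `hasEntireLFunction_of_yanZhu`,
  `yanZhu_analyticRank_eq_one_of_selmerCorank_eq_one_iff_hasEntireLFunction_and` — what the fact
  carries UNCONDITIONALLY in the tree's semantics: since a curve whose `L`-series has no entire
  continuation has `W.analyticRank = 0` (`BSDRootNumberNoContinuationProofs`), the conclusion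
  `ord_{s=1} L(E, s) = 1` certifies `W.HasEntireLFunction` for every curve in the fact's scope, and
  the fact is equivalent to "continuation in scope" ∧ "its restriction to curves with entire
  `L`-function" — so the continuation / modularity leaf (f) of both decompositions is forced.

No named fact is introduced here (D-0026); no leaf is discharged: (a), (c), (e'), (f) are major
theorems (Dokchitser–Dokchitser; Kato; Skinner–Urban + Wan + Hsieh + Castella–Grossi–Skinner +
Burungale–Castella–Kim/–Skinner + Cornut–Vatsal + Gross–Zagier, resp. BCGS; Wiles et al.) and (b)
is analytic (Friedberg–Hoffstein). The trust base of the fact is thereby pinned to these five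
printed results, four of which are tree-wide named facts shared with bsd.S20/S25.

## Design notes

* Conventions as in `BSDSelmerPConverse`: `ord_{s=1} L(E/K, s)` is `analyticRankEK W K` (order
  at `1` of `L(E, s) L(E^{(d_K)}, s)`), "`p` splits in `K`" is `SatisfiesHeegnerHypothesis p K`,
  the Heegner hypothesis is `SatisfiesHeegnerHypothesis (W.conductorNorm ℤ) K`, `E^{(d_K)}` is
  `W.quadraticTwist (NumberField.discr K)`, `corank_{ℤ_p} Sel_{p^∞}(E/K)` is
  `(W.baseChange K).selmerCorank p`.
* `5 ≤ p` (the fact's hypothesis) is used only as `3 < p` for (e') and is otherwise idle; the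
  fact's `[W.IsGloballyMinimal]` serves only to read `a_p = W.frobeniusTrace p`.
* What is NOT here: the `K`-level input (e') as a named fact (it is a distinct published result —
  BCGS Cor. 1 / Yan–Zhu §4.6 — and belongs in its own file), and any of (1) ⇔ (3), `r = 0`, or the
  `p`-part of the BSD formula of Thm. 4.15.

## References

* [YanZhu2024MainConjNonCM] X. Yan, X. Zhu, *Main conjectures for non-CM elliptic curves at good
  ordinary primes*, arXiv:2412.20078 = J. Algebra (2026), doi:10.1016/j.jalgebra.2026.01.016:
  Cor. 1.4 (§1.1, chunk 3 of the held text), §4.5 (chunk 11), Thm. 4.15 and its proof (§4.6,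
  chunk 12).
* [BurungaleEtAl2026] A. Burungale, F. Castella, G. Grossi, C. Skinner, *Non-vanishing of
  Kolyvagin systems and Iwasawa theory*, Camb. J. Math. 14 (2026), 285–348 = arXiv:2312.09301:
  Thm. 1 and Cor. 1 (§0.1, chunks 3–4 of the held text).
* [BurungaleSkinnerTianWan2024] A. Burungale, C. Skinner, Y. Tian, X. Wan, arXiv:2409.01350v2,
  proof of Thm. 12.3 (Part II, §12.1.2; arXiv v2 PDF p. 96) — the descent template.
  LOCATOR ERRATUM (2026-08-25, checked against the arXiv v2 PDF): earlier revisions of this file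
  gave this as "Part II, proof of Thm. 4.3 (p. 82)" — the numbering of the held TeX-derived text
  (`lit read arxiv:2409.01350`), whose "p. N" are chunk indices and whose extraction restarts the
  section counter inside Part II (held §s = printed §(s+8)); the quoted words are unchanged.
* [FriedbergHoffstein1995]; [Kato2004Asterisque] Thm. 14.2; [DokchitserDokchitserAnnals2010]
  Thm. 1.4, Lemma 4.14; [GrossZagier1986] I.§7.
* [HoffsteinLuo1997] J. Hoffstein, W. Luo, Math. Res. Lett. 4 (1997), Theorem (pp. 435–436: the
  "moreover `d ≡ 1 (mod 8)`, `χ_d(p) = 1` for `p ∈ S`" clause).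
-/

noncomputable section

open scoped Classical

open WeierstrassCurve

namespace Literature.NumberTheory.EllipticCurves

/-- **Yan–Zhu, Cor. 1.4 = Thm. 4.15, (2) ⇒ (3) for `r = 1`, assembled from its printed
ingredients** (arXiv:2412.20078 = J. Algebra (2026), §4.6, proof of Thm. 4.15, chunk 12 of the
held text: "For (2) ⇒ (3), we can choose an imaginary quadratic field `K` such that
`ord_{s=1} L(E^K, s) ≤ 1` and `(E, K)` satisfies the Heegner hypothesis by [FH]. Similarly to
[Wan], by applying descent arguments to (the rational part of) Theorem 4.12 (2) and using
Gross-Zagier formula, we have `corank_{ℤ_p} Sel_{p^∞}(E/K) = 1` implies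
`ord_{s=1} L(E/K, s) = 1`, therefore we have (2) ⇒ (3) holds"), i.e. the tree's named fact
`yanZhu_analyticRank_eq_one_of_selmerCorank_eq_one`, from: (a) the `p`-parity theorem (`hpar`,
tree `p_parity`: corank `1` forces `w(E) = -1`, so the twist by a Heegner field has sign `+1` and
"`ord L(E^K, s) ≤ 1`" reads `L(E^{(d_K)}, 1) ≠ 0`); (b) the Friedberg–Hoffstein field (`hFH`:
`K` imaginary quadratic with the Heegner hypothesis for `N`, `p` split — the standing hypothesis
of §4.5 under which Thm. 4.12 is stated — and `L(E^{(d_K)}, 1) ≠ 0`); (c) Kato's finiteness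
theorem (`hKato`, tree `kato_finite_of_L_one_ne_zero`: the `p^∞`-Selmer group of `E^{(d_K)}` is
finite, of corank `0`, `selmerCorank_eq_zero_of_finite`); (d) the tree theorem
`selmerCorank_baseChange_quadratic_holds` (`corank Sel_{p^∞}(E/K) = 1 + 0`); (e') the displayed
`K`-level `p`-converse WITHOUT ramification hypothesis (`hL`, spelled out in the special case
used: `p > 3` good ordinary, `ρ̄_{E,p}` surjective — whence `ρ̄_E|_{G_K}` absolutely irreducible
for the quadratic `K` —, `K` imaginary quadratic with the Heegner hypothesis for
`N = W.conductorNorm ℤ` and `p` split; also Burungale–Castella–Grossi–Skinner, Camb. J. Math. 14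
(2026), Cor. 1, rank-one case, under (disc)); (f) modularity (`hE`, tree `hasEntireLFunction_rat`),
through `analyticRankEK_eq_add_of`: `ord L(E/K) = ord L(E) + ord L(E^{(d_K)}) = ord L(E) + 0`
(`analyticRank_eq_zero_of_entireLFunction_one_ne_zero`). The proof is the descent printed in
Burungale–Skinner–Tian–Wan, proof of Thm. 12.3 (tree:
`analyticRank_eq_one_of_selmerCorank_eq_one_of_padicSurjective`) with (e') in place of its (e).
[cite: YanZhu2024MainConjNonCM, Thm. 4.15 (proof, §4.6) and Cor. 1.4]
[cite: BurungaleEtAl2026, Cor. 1 (arXiv:2312.09301, §0.1, p. 4)]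
[cite: BurungaleSkinnerTianWan2024, proof of Thm. 12.3 (p. 96)] -/
theorem yanZhu_analyticRank_eq_one_of_selmerCorank_eq_one_of_leaves
    (hpar : ∀ (W : WeierstrassCurve ℚ) [W.IsElliptic] (p : ℕ) [Fact p.Prime], p_parity W p)
    (hFH : friedbergHoffstein_exists_heegnerField_split_twist_ne_zero)
    (hKato : ∀ (W : WeierstrassCurve ℚ) [W.IsElliptic] (p : ℕ) [Fact p.Prime],
      kato_finite_of_L_one_ne_zero W p)
    (hL : ∀ (W : WeierstrassCurve ℚ) [W.IsElliptic] [W.IsGloballyMinimal] (p : ℕ) [Fact p.Prime],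
      3 < p → W.HasGoodReductionAtPrime p → ¬ (p : ℤ) ∣ W.frobeniusTrace p →
      W.HasSurjectiveModNGaloisRep p →
      ∀ (K : Type) [Field K] [NumberField K], IsImaginaryQuadratic K →
        SatisfiesHeegnerHypothesis (W.conductorNorm ℤ) K → SatisfiesHeegnerHypothesis p K →
        (W.baseChange K).selmerCorank p = 1 → analyticRankEK W K = 1)
    (hE : hasEntireLFunction_rat) :
    yanZhu_analyticRank_eq_one_of_selmerCorank_eq_one := by
  intro W _ _ p _ hp5 hgood hord hsurj hcorank
  -- (a) parity: the root number is `-1`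
  have hw : W.rootNumber = -1 := by
    have h := hpar W p
    unfold p_parity at h
    rw [hcorank, pow_one] at h
    exact h.symm
  -- (b) the auxiliary imaginary quadratic field ([FH]): Heegner hypothesis, `p` split,
  -- `L(E^{(d_K)}, 1) ≠ 0`
  obtain ⟨K, _, _, hK, -, hHN, hHp, hL1⟩ := hFH W hw p (Fact.out : p.Prime) 0
  -- (c) Kato: the `p^∞`-Selmer group of the twist is finite, hence of corank `0`
  have hd : (NumberField.discr K : ℚ) ≠ 0 := by exact_mod_cast NumberField.discr_ne_zero K
  haveI := W.isElliptic_quadraticTwist hd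
  obtain ⟨-, -, hfin⟩ := hKato (W.quadraticTwist (NumberField.discr K : ℚ)) p hL1
  haveI := hfin
  have h0 : (W.quadraticTwist (NumberField.discr K : ℚ)).selmerCorank p = 0 :=
    (W.quadraticTwist (NumberField.discr K : ℚ)).selmerCorank_eq_zero_of_finite p
  -- (d) the corank over `K` is `1 + 0 = 1`
  have hK1 : (W.baseChange K).selmerCorank p = 1 := by
    rw [selmerCorank_baseChange_quadratic_holds W K hK.1 p, hcorank, h0]
  -- (e') the `p`-converse over `K` (no ramification hypothesis)
  have hEK : analyticRankEK W K = 1 := hL W p (by omega) hgood hord hsurj K hK hHN hHp hK1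
  -- (f) factorisation of the analytic rank over `K`
  rw [analyticRankEK_eq_add_of hE W K, analyticRank_eq_zero_of_entireLFunction_one_ne_zero _ hL1,
    add_zero] at hEK
  exact hEK

/-! ### The interim bsd.S25 statement is a formal consequence -/

/-- The interim bsd.S25 statement `analyticRank_eq_one_of_selmerCorank_eq_one` (`BSDSelmer.lean`:
`p ≥ 5` good ordinary, `ρ̄_{E,p}` surjective, (ram) in Tate-curve form `haux`, the localisation
hypothesis `hloc`, corank `1`) follows from Yan–Zhu's Cor. 1.4 in the tree's form
(`yanZhu_analyticRank_eq_one_of_selmerCorank_eq_one`) by simply dropping `haux` and `hloc` —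
whereas its derivation from Burungale–Skinner–Tian–Wan, Thm. 1.10
(`analyticRank_eq_one_of_selmerCorank_eq_one_of_bstw`) consumes `haux` = (ram).
[cite: YanZhu2024MainConjNonCM, Cor. 1.4] -/
theorem analyticRank_eq_one_of_selmerCorank_eq_one_of_yanZhu
    (h : yanZhu_analyticRank_eq_one_of_selmerCorank_eq_one) :
    analyticRank_eq_one_of_selmerCorank_eq_one := by
  intro W _ _ p _ hp hgood hord hsurj _haux _hloc hcorank
  exact h W p hp hgood hord hsurj hcorank

/-- Likewise the `p ≥ 5` part of Burungale–Skinner–Tian–Wan, Thm. 1.10 as transcribed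
(`burungaleSkinnerTianWan_analyticRank_eq_one_of_selmerCorank_eq_one`, stated for all odd `p`)
follows from Yan–Zhu's Cor. 1.4 in the tree's form, (ram) being dropped; the case `p = 3` of
Thm. 1.10 is not covered by the `p ≥ 5` fact. [cite: YanZhu2024MainConjNonCM, Cor. 1.4]
[cite: BurungaleSkinnerTianWan2024, Thm. 1.10] -/
theorem burungaleSkinnerTianWan_analyticRank_eq_one_of_selmerCorank_eq_one_of_yanZhu_of_five_le
    (h : yanZhu_analyticRank_eq_one_of_selmerCorank_eq_one)
    (W : WeierstrassCurve ℚ) [W.IsElliptic] [W.IsGloballyMinimal] (p : ℕ) [Fact p.Prime]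
    (hp : 5 ≤ p) (hgood : W.HasGoodReductionAtPrime p) (hord : ¬ (p : ℤ) ∣ W.frobeniusTrace p)
    (hsurj : W.HasSurjectiveModNGaloisRep p)
    (_hram : ∃ ℓ : ℕ, ∃ _ : Fact ℓ.Prime, ℓ ≠ p ∧ W.HasMultiplicativeReductionAtPrime ℓ ∧
      ¬ p ∣ padicValInt ℓ W.minimalDiscriminantInt)
    (hcorank : W.selmerCorank p = 1) : W.analyticRank = 1 :=
  h W p hp hgood hord hsurj hcorank

/-! ### The same fact over the common leaf set of the bsd.S19/S20/S25 cluster -/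

/-- **Yan–Zhu, proof of Thm. 4.15, (2) ⇒ (3), from the sign onwards** — the descent of
`yanZhu_analyticRank_eq_one_of_selmerCorank_eq_one_of_leaves` with the sign `w(E) = -1` of the
curve in hand as the hypothesis `hw` (instead of the `p`-parity theorem for all curves and
primes) and explicit binders; the analogue, without (ram), of
`analyticRank_eq_one_of_selmerCorank_eq_one_of_rootNumber_eq_neg_one`
(`BSDSelmerPConverseCommonLeavesProofs`). Inputs: (b) the Friedberg–Hoffstein field (`hFH`),
(c) Kato's finiteness theorem (`hKato`), (e') the `K`-level `p`-converse without ramification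
hypothesis (`hL`, inline: Yan–Zhu §4.6 display / Burungale–Castella–Grossi–Skinner Cor. 1),
(f) the entire continuation (`hE`); (d) is the theorem `selmerCorank_baseChange_quadratic_holds`.
[cite: YanZhu2024MainConjNonCM, Thm. 4.15 (proof, §4.6)]
[cite: BurungaleSkinnerTianWan2024, proof of Thm. 12.3 (p. 96)] -/
theorem yanZhu_analyticRank_eq_one_of_selmerCorank_eq_one_of_rootNumber_eq_neg_one
    (hFH : friedbergHoffstein_exists_heegnerField_split_twist_ne_zero)
    (hKato : ∀ (W : WeierstrassCurve ℚ) [W.IsElliptic] (p : ℕ) [Fact p.Prime],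
      kato_finite_of_L_one_ne_zero W p)
    (hL : ∀ (W : WeierstrassCurve ℚ) [W.IsElliptic] [W.IsGloballyMinimal] (p : ℕ) [Fact p.Prime],
      3 < p → W.HasGoodReductionAtPrime p → ¬ (p : ℤ) ∣ W.frobeniusTrace p →
      W.HasSurjectiveModNGaloisRep p →
      ∀ (K : Type) [Field K] [NumberField K], IsImaginaryQuadratic K →
        SatisfiesHeegnerHypothesis (W.conductorNorm ℤ) K → SatisfiesHeegnerHypothesis p K →
        (W.baseChange K).selmerCorank p = 1 → analyticRankEK W K = 1)
    (hE : hasEntireLFunction_rat)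
    (W : WeierstrassCurve ℚ) [W.IsElliptic] [W.IsGloballyMinimal] (p : ℕ) [Fact p.Prime]
    (hp : 3 < p) (hgood : W.HasGoodReductionAtPrime p) (hord : ¬ (p : ℤ) ∣ W.frobeniusTrace p)
    (hsurj : W.HasSurjectiveModNGaloisRep p) (hw : W.rootNumber = -1)
    (hcorank : W.selmerCorank p = 1) : W.analyticRank = 1 := by
  -- (b) the auxiliary imaginary quadratic field
  obtain ⟨K, _, _, hK, -, hHN, hHp, hL1⟩ := hFH W hw p (Fact.out : p.Prime) 0
  -- (c) Kato: the `p^∞`-Selmer group of the twist is finite, hence of corank `0`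
  have hd : (NumberField.discr K : ℚ) ≠ 0 := by exact_mod_cast NumberField.discr_ne_zero K
  haveI := W.isElliptic_quadraticTwist hd
  obtain ⟨-, -, hfin⟩ := hKato (W.quadraticTwist (NumberField.discr K : ℚ)) p hL1
  haveI := hfin
  have h0 : (W.quadraticTwist (NumberField.discr K : ℚ)).selmerCorank p = 0 :=
    (W.quadraticTwist (NumberField.discr K : ℚ)).selmerCorank_eq_zero_of_finite p
  -- (d) the corank over `K` is `1 + 0 = 1`
  have hK1 : (W.baseChange K).selmerCorank p = 1 := by
    rw [selmerCorank_baseChange_quadratic_holds W K hK.1 p, hcorank, h0]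
  -- (e') the `p`-converse over `K` (no ramification hypothesis)
  have hEK : analyticRankEK W K = 1 := hL W p hp hgood hord hsurj K hK hHN hHp hK1
  -- (f) factorisation of the analytic rank over `K`
  rw [analyticRankEK_eq_add_of hE W K, analyticRank_eq_zero_of_entireLFunction_one_ne_zero _ hL1,
    add_zero] at hEK
  exact hEK

/-- **Yan–Zhu, Cor. 1.4 in the tree's form, over the common leaf set** of the bsd.S19/S20/S25
cluster (as `burungaleSkinnerTianWan_analyticRank_eq_one_of_selmerCorank_eq_one_of_exists_isNewformOf`
does for BSTW Thm. 1.10): the Modularity Theorem `hmod` (`ModularForms.exists_isNewformOf`: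
entire continuation (f), `hasEntireLFunction_rat_of_exists_isNewformOf`, and the parity of the
analytic rank), Waldspurger `hWa`, Murty–Murty (Remark 1) `hMM`, Gross–Zagier–Kolyvagin `hGZK`
(`rank_eq_analyticRank_of_analyticRank_le_one`, which also yields (c) Kato's finiteness theorem,
`kato_finite_of_L_one_ne_zero_of_rank_eq_analyticRank`) and `rk_p(E/M₀)` odd `hDD` — these give
the sign (a) for the odd prime `p` (`rootNumber_eq_neg_one_of_selmerCorank_eq_one_of_facts`,
Dokchitser–Dokchitser 2010, §4.6) —, (b) the Friedberg–Hoffstein field `hFH`, and (e') the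
`K`-level `p`-converse without ramification hypothesis, inline (`hL`). So, relative to the tree,
the Yan–Zhu fact and the BSTW fact differ exactly in their `K`-level leaf ((e') without (ram)
versus (e) with (ram)). [cite: YanZhu2024MainConjNonCM, Cor. 1.4 and Thm. 4.15 (proof, §4.6)]
[cite: DokchitserDokchitserAnnals2010, Thm. 1.4 and §4.6] -/
theorem yanZhu_analyticRank_eq_one_of_selmerCorank_eq_one_of_exists_isNewformOf
    (hmod : ModularForms.exists_isNewformOf)
    (hWa : waldspurger_exists_heegnerField_twist_ne_zero)
    (hMM : murtyMurty_exists_heegnerField_twist_simpleZero_of_rootNumber_eq_one)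
    (hGZK : rank_eq_analyticRank_of_analyticRank_le_one)
    (hDD : dokchitser_selmerCorank_baseChange_mod_two_eq)
    (hFH : friedbergHoffstein_exists_heegnerField_split_twist_ne_zero)
    (hL : ∀ (W : WeierstrassCurve ℚ) [W.IsElliptic] [W.IsGloballyMinimal] (p : ℕ) [Fact p.Prime],
      3 < p → W.HasGoodReductionAtPrime p → ¬ (p : ℤ) ∣ W.frobeniusTrace p →
      W.HasSurjectiveModNGaloisRep p →
      ∀ (K : Type) [Field K] [NumberField K], IsImaginaryQuadratic K →
        SatisfiesHeegnerHypothesis (W.conductorNorm ℤ) K → SatisfiesHeegnerHypothesis p K →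
        (W.baseChange K).selmerCorank p = 1 → analyticRankEK W K = 1) :
    yanZhu_analyticRank_eq_one_of_selmerCorank_eq_one := by
  intro W _ _ p _ hp5 hgood hord hsurj hcorank
  exact yanZhu_analyticRank_eq_one_of_selmerCorank_eq_one_of_rootNumber_eq_neg_one hFH
    (fun W _ p _ ↦ kato_finite_of_L_one_ne_zero_of_rank_eq_analyticRank W p hGZK) hL
    (hasEntireLFunction_rat_of_exists_isNewformOf hmod) W p (by omega) hgood hord hsurj
    (rootNumber_eq_neg_one_of_selmerCorank_eq_one_of_facts hmod hWa hMM hGZK hDD W p (by omega)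
      hcorank)
    hcorank

/-! ### A second decomposition: the auxiliary field from Hoffstein–Luo, and BCGS Cor. 1 as printed

The library reduces leaf (b) (Friedberg–Hoffstein) to the Modularity Theorem and Hoffstein–Luo
1997 (`friedbergHoffstein_exists_heegnerField_split_twist_ne_zero_of_hoffsteinLuo`). Hoffstein–Luo's
square-free `d` is `≡ 1 (mod 8)` (their "moreover" clause, kept in the tree's transcription
`HoffsteinLuo1997_exists_twist_L_one_ne_zero`), which the fact (b) forgets. Remembering it, the
auxiliary field `K = ℚ(√d)` has ODD discriminant `d_K = d ≠ -3`, i.e. satisfies hypothesis (disc) of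
Burungale–Castella–Grossi–Skinner, Thm. 1 — so that over this `K` the `K`-level leaf may be taken
to be their Thm. 1 + Cor. 1 (rank-one case) with exactly the printed hypotheses ((Heeg), (disc),
(tor), `p` split; `p > 3` with (irr), the case in which the rational anticyclotomic main
conjecture they assume is supplied in their paper), rather than Yan–Zhu's §4.6 display: (irr) and
(tor) `E(K)[p] = 0` follow from the surjectivity of `ρ̄_{E,p}` by tree theorems
(`hasIrreducibleModPGaloisRep_of_hasSurjectiveModNGaloisRep`; Gross 1991, §2,
`torsionBy_eq_bot_of_isImaginaryQuadratic`). -/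

/-- **The auxiliary field from Hoffstein–Luo, with `d_K ≡ 1 (mod 8)`.** For `E/ℚ` elliptic with
`w(E) = -1`, a prime `p` and a bound `B`, the Modularity Theorem (`hmod`) and Hoffstein–Luo 1997
(`hHL`: a square-free `d ≡ 1 (mod 8)`, `|d| > B`, `χ_d = 1` on a prescribed finite set of odd
primes, `L(E^{(d)}, 1) ≠ 0`; `d < 0` by the sign of the functional equation of the twist,
`exists_neg_fundamental_twist_ne_zero_of_hoffsteinLuo`) give an imaginary quadratic `K = ℚ(√d)`
with `|d_K| > B`, every `ℓ ∣ N_E` split, `p` split, `d_K ≡ 1 (mod 8)` and `L(E^{(d_K)}, 1) ≠ 0` —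
the conclusion of `friedbergHoffstein_exists_heegnerField_split_twist_ne_zero` together with the
congruence it drops (dictionary `K ↦ d_K`: `exists_heegnerField_iff_exists_fundamental`).
[cite: HoffsteinLuo1997, Theorem (§1, pp. 435–436)] [cite: MurtyMurty1997, Ch. 6 §1, p. 96] -/
theorem exists_heegnerField_split_twist_ne_zero_discr_emod_eight_of_hoffsteinLuo
    (hmod : ModularForms.exists_isNewformOf) (hHL : HoffsteinLuo1997_exists_twist_L_one_ne_zero)
    (W : WeierstrassCurve ℚ) [W.IsElliptic] (hw : W.rootNumber = -1) {p : ℕ} (hp : p.Prime)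
    (B : ℕ) :
    ∃ (K : Type) (_ : Field K) (_ : NumberField K),
      IsImaginaryQuadratic K ∧ B < (NumberField.discr K).natAbs ∧
        SatisfiesHeegnerHypothesis (W.conductorNorm ℤ) K ∧ SatisfiesHeegnerHypothesis p K ∧
          NumberField.discr K % 8 = 1 ∧
            (W.quadraticTwist (NumberField.discr K : ℚ)).entireLFunction 1 ≠ 0 := by
  obtain ⟨d, hdneg, hsq, hd8, hBd, hjacS, hjacN, hL⟩ :=
    exists_neg_fundamental_twist_ne_zero_of_hoffsteinLuo hmod hHL W hw {p} B
  have hkr : ∀ q : ℕ, q.Prime → q ∣ W.conductorNorm ℤ * p →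
      (q = 2 → d % 8 = 1) ∧ (q ≠ 2 → jacobiSym d q = 1) := by
    intro q hq hqNp
    refine ⟨fun _ ↦ hd8, fun hq2 ↦ ?_⟩
    rcases (Nat.Prime.dvd_mul hq).mp hqNp with hqN | hqp
    · exact hjacN q hq hqN hq2
    · have hqp' : q = p := (Nat.prime_dvd_prime_iff_eq hq hp).mp hqp
      subst hqp'
      exact hjacS q (Finset.mem_singleton_self q) hq hq2
  obtain ⟨K, _, _, hK, hB, hH, hLK⟩ :=
    (exists_heegnerField_iff_exists_fundamental (W.conductorNorm ℤ * p) B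
      (fun D ↦ D % 8 = 1 ∧ (W.quadraticTwist (D : ℚ)).entireLFunction 1 ≠ 0)).mpr
      ⟨d, hdneg, Or.inl ⟨by omega, hsq, by omega⟩, hBd, hkr, hd8, hL⟩
  exact ⟨K, _, _, hK, hB, hH.of_dvd (dvd_mul_right _ _), hH.of_dvd (dvd_mul_left _ _), hLK.1,
    hLK.2⟩

/-- **Yan–Zhu (2) ⇒ (3), `r = 1`, from the sign onwards, with Burungale–Castella–Grossi–Skinner's
Cor. 1 as the `K`-level leaf.** Inputs: the Modularity Theorem (`hmod`: the entire continuation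
(f) and the sign of the twists), Hoffstein–Luo 1997 (`hHL`: the auxiliary field (b), here with
(disc)), Kato's finiteness theorem (`hKato`, (c)), and — inline, as `hBCGS` — Burungale, Castella,
Grossi, Skinner, *Non-vanishing of Kolyvagin systems and Iwasawa theory*, Camb. J. Math. 14 (2026)
= arXiv:2312.09301, **Thm. 1 with Cor. 1, rank-one case** (§0.1, pp. 3–4 of the held text): "Let
`E/ℚ` be an elliptic curve, and let `p` be an odd prime of good ordinary reduction for `E`. Let `K`
be a quadratic imaginary field satisfying (Heeg) [every prime `ℓ ∣ N` splits in `K`], (disc) [`D_K`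
is odd and `D_K ≠ -3`], (tor) [`E(K)[p] = 0`], and such that `p` splits in `K`. Assume that the
rational anticyclotomic Main Conjecture holds [in particular: `p > 3` satisfies (irr), `E[p]` an
irreducible `G_ℚ`-module] … Corollary 1. For `E`, `p` and `K` as in Theorem 1 … In the rank one
case it yields a `p`-converse to the Gross–Zagier and Kolyvagin theorem:
`corank_{ℤ_p} Sel_{p^∞}(E/K) = 1 ⟹ ord_{s=1} L(E/K, s) = 1`" — transcribed with `p > 3`, (irr)
(`HasIrreducibleModPGaloisRep`), (Heeg) for `N = W.conductorNorm ℤ`, (disc) as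
`Odd d_K ∧ d_K ≠ -3`, (tor) as `E(K)[p] = ⊥` (`AddSubgroup.torsionBy`), `p` split as
`SatisfiesHeegnerHypothesis p K`, and `ord_{s=1} L(E/K, s)` as `analyticRankEK W K`. For the curve
in hand (`p > 3` good ordinary, `ρ̄_{E,p}` surjective, `w(E) = -1`, corank `1`): take `K` from
`exists_heegnerField_split_twist_ne_zero_discr_emod_eight_of_hoffsteinLuo` (so (Heeg), `p` split,
(disc), `L(E^{(d_K)}, 1) ≠ 0`); (irr) and (tor) from surjectivity; corank over `K` is `1 + 0`
(Kato for the twist, `selmerCorank_baseChange_quadratic_holds`); `hBCGS` gives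
`ord_{s=1} L(E/K, s) = 1`, and `ord L(E/K) = ord L(E) + ord L(E^{(d_K)}) = ord L(E) + 0`.
[cite: BurungaleEtAl2026, Thm. 1 and Cor. 1 (arXiv:2312.09301, §0.1, pp. 3–4)]
[cite: YanZhu2024MainConjNonCM, Thm. 4.15 (proof, §4.6)]
[cite: HoffsteinLuo1997, Theorem (§1, pp. 435–436)] [cite: GrossLMS1991, §2 (after (2.2))] -/
theorem yanZhu_analyticRank_eq_one_of_selmerCorank_eq_one_of_bcgs_of_rootNumber_eq_neg_one
    (hmod : ModularForms.exists_isNewformOf) (hHL : HoffsteinLuo1997_exists_twist_L_one_ne_zero)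
    (hKato : ∀ (W : WeierstrassCurve ℚ) [W.IsElliptic] (p : ℕ) [Fact p.Prime],
      kato_finite_of_L_one_ne_zero W p)
    (hBCGS : ∀ (W : WeierstrassCurve ℚ) [W.IsElliptic] [W.IsGloballyMinimal] (p : ℕ) [Fact p.Prime],
      3 < p → W.HasGoodReductionAtPrime p → ¬ (p : ℤ) ∣ W.frobeniusTrace p →
      W.HasIrreducibleModPGaloisRep p →
      ∀ (K : Type) [Field K] [NumberField K], IsImaginaryQuadratic K →
        SatisfiesHeegnerHypothesis (W.conductorNorm ℤ) K →
        Odd (NumberField.discr K) → NumberField.discr K ≠ -3 →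
        AddSubgroup.torsionBy (W.baseChange K).toAffine.Point (p : ℤ) = ⊥ →
        SatisfiesHeegnerHypothesis p K →
        (W.baseChange K).selmerCorank p = 1 → analyticRankEK W K = 1)
    (W : WeierstrassCurve ℚ) [W.IsElliptic] [W.IsGloballyMinimal] (p : ℕ) [Fact p.Prime]
    (hp : 3 < p) (hgood : W.HasGoodReductionAtPrime p) (hord : ¬ (p : ℤ) ∣ W.frobeniusTrace p)
    (hsurj : W.HasSurjectiveModNGaloisRep p) (hw : W.rootNumber = -1)
    (hcorank : W.selmerCorank p = 1) : W.analyticRank = 1 := by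
  have hpP : p.Prime := Fact.out
  -- (b) the auxiliary imaginary quadratic field, from Hoffstein–Luo, with `d_K ≡ 1 (mod 8)`
  obtain ⟨K, _, _, hK, -, hHN, hHp, hd8, hL1⟩ :=
    exists_heegnerField_split_twist_ne_zero_discr_emod_eight_of_hoffsteinLuo hmod hHL W hw hpP 0
  -- (disc): `d_K` odd and `d_K ≠ -3`
  have hodd : Odd (NumberField.discr K) := Int.odd_iff.mpr (by omega)
  have hne3 : NumberField.discr K ≠ -3 := by omega
  -- (c) Kato: the `p^∞`-Selmer group of the twist is finite, hence of corank `0`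
  have hd : (NumberField.discr K : ℚ) ≠ 0 := by exact_mod_cast NumberField.discr_ne_zero K
  haveI := W.isElliptic_quadraticTwist hd
  obtain ⟨-, -, hfin⟩ := hKato (W.quadraticTwist (NumberField.discr K : ℚ)) p hL1
  haveI := hfin
  have h0 : (W.quadraticTwist (NumberField.discr K : ℚ)).selmerCorank p = 0 :=
    (W.quadraticTwist (NumberField.discr K : ℚ)).selmerCorank_eq_zero_of_finite p
  -- (d) the corank over `K` is `1 + 0 = 1`
  have hK1 : (W.baseChange K).selmerCorank p = 1 := by
    rw [selmerCorank_baseChange_quadratic_holds W K hK.1 p, hcorank, h0]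
  -- (irr) and (tor) from the surjectivity of `ρ̄_{E,p}`
  haveI : NeZero (p : ℚ) := ⟨by exact_mod_cast hpP.ne_zero⟩
  have hirr : W.HasIrreducibleModPGaloisRep p :=
    hasIrreducibleModPGaloisRep_of_hasSurjectiveModNGaloisRep W p hsurj
  have htor : AddSubgroup.torsionBy (W.baseChange K).toAffine.Point (p : ℤ) = ⊥ :=
    torsionBy_eq_bot_of_isImaginaryQuadratic W K hK hpP (by omega) hsurj
  -- (e'') Burungale–Castella–Grossi–Skinner, Cor. 1 (rank-one case) over this `K`
  have hEK : analyticRankEK W K = 1 :=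
    hBCGS W p hp hgood hord hirr K hK hHN hodd hne3 htor hHp hK1
  -- (f) factorisation of the analytic rank over `K`
  rw [analyticRankEK_eq_add_of (hasEntireLFunction_rat_of_exists_isNewformOf hmod) W K,
    analyticRank_eq_zero_of_entireLFunction_one_ne_zero _ hL1, add_zero] at hEK
  exact hEK

/-- **Yan–Zhu, Cor. 1.4 in the tree's form, second decomposition**: from (a) the `p`-parity
theorem (`hpar`, tree fact `p_parity`), the Modularity Theorem (`hmod`), Hoffstein–Luo 1997
(`hHL`), Kato's finiteness theorem (`hKato`) and Burungale–Castella–Grossi–Skinner, Thm. 1 +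
Cor. 1 (rank-one case) as printed, inline (`hBCGS`; see
`yanZhu_analyticRank_eq_one_of_selmerCorank_eq_one_of_bcgs_of_rootNumber_eq_neg_one`). Relative to
`yanZhu_analyticRank_eq_one_of_selmerCorank_eq_one_of_leaves`: Friedberg–Hoffstein is replaced by
the library's Modularity + Hoffstein–Luo, and the `K`-level leaf by BCGS's, whose extra hypotheses
(disc), (tor), (irr) are discharged. [cite: BurungaleEtAl2026, Thm. 1 and Cor. 1 (arXiv:2312.09301, §0.1, pp. 3–4)]
[cite: YanZhu2024MainConjNonCM, Cor. 1.4 and Thm. 4.15 (proof, §4.6)] -/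
theorem yanZhu_analyticRank_eq_one_of_selmerCorank_eq_one_of_bcgs
    (hpar : ∀ (W : WeierstrassCurve ℚ) [W.IsElliptic] (p : ℕ) [Fact p.Prime], p_parity W p)
    (hmod : ModularForms.exists_isNewformOf) (hHL : HoffsteinLuo1997_exists_twist_L_one_ne_zero)
    (hKato : ∀ (W : WeierstrassCurve ℚ) [W.IsElliptic] (p : ℕ) [Fact p.Prime],
      kato_finite_of_L_one_ne_zero W p)
    (hBCGS : ∀ (W : WeierstrassCurve ℚ) [W.IsElliptic] [W.IsGloballyMinimal] (p : ℕ) [Fact p.Prime],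
      3 < p → W.HasGoodReductionAtPrime p → ¬ (p : ℤ) ∣ W.frobeniusTrace p →
      W.HasIrreducibleModPGaloisRep p →
      ∀ (K : Type) [Field K] [NumberField K], IsImaginaryQuadratic K →
        SatisfiesHeegnerHypothesis (W.conductorNorm ℤ) K →
        Odd (NumberField.discr K) → NumberField.discr K ≠ -3 →
        AddSubgroup.torsionBy (W.baseChange K).toAffine.Point (p : ℤ) = ⊥ →
        SatisfiesHeegnerHypothesis p K →
        (W.baseChange K).selmerCorank p = 1 → analyticRankEK W K = 1) :
    yanZhu_analyticRank_eq_one_of_selmerCorank_eq_one := by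
  intro W _ _ p _ hp5 hgood hord hsurj hcorank
  -- (a) parity: the root number is `-1`
  have hw : W.rootNumber = -1 := by
    have h := hpar W p
    unfold p_parity at h
    rw [hcorank, pow_one] at h
    exact h.symm
  exact yanZhu_analyticRank_eq_one_of_selmerCorank_eq_one_of_bcgs_of_rootNumber_eq_neg_one hmod
    hHL hKato hBCGS W p (by omega) hgood hord hsurj hw hcorank

/-- **The same, over the common leaf set of the bsd.S19/S20/S25 cluster with Hoffstein–Luo in place
of both Waldspurger and Friedberg–Hoffstein**: the Modularity Theorem `hmod`, Hoffstein–Luo `hHL`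
(whence Waldspurger's twist, `waldspurger_exists_heegnerField_twist_ne_zero_of_hoffsteinLuo`, and
the auxiliary field with (disc)), Murty–Murty (Remark 1) `hMM`, Gross–Zagier–Kolyvagin over `ℚ`
`hGZK` (`rank_eq_analyticRank_of_analyticRank_le_one`, which also yields Kato's finiteness,
`kato_finite_of_L_one_ne_zero_of_rank_eq_analyticRank`), `rk_p(E/M₀)` odd `hDD` — these give the
sign `w(E) = -1` for the odd prime `p` (`rootNumber_eq_neg_one_of_selmerCorank_eq_one_of_facts`) —
and BCGS Thm. 1 + Cor. 1 inline (`hBCGS`). So along this decomposition the Yan–Zhu fact rests on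
exactly: Modularity, Hoffstein–Luo, Murty–Murty, Gross–Zagier–Kolyvagin over `ℚ`,
Dokchitser–Dokchitser's `rk_p` parity, and BCGS Cor. 1.
[cite: BurungaleEtAl2026, Thm. 1 and Cor. 1 (arXiv:2312.09301, §0.1, pp. 3–4)]
[cite: YanZhu2024MainConjNonCM, Cor. 1.4 and Thm. 4.15 (proof, §4.6)]
[cite: DokchitserDokchitserAnnals2010, Thm. 1.4 and §4.6] -/
theorem yanZhu_analyticRank_eq_one_of_selmerCorank_eq_one_of_bcgs_of_exists_isNewformOf
    (hmod : ModularForms.exists_isNewformOf) (hHL : HoffsteinLuo1997_exists_twist_L_one_ne_zero)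
    (hMM : murtyMurty_exists_heegnerField_twist_simpleZero_of_rootNumber_eq_one)
    (hGZK : rank_eq_analyticRank_of_analyticRank_le_one)
    (hDD : dokchitser_selmerCorank_baseChange_mod_two_eq)
    (hBCGS : ∀ (W : WeierstrassCurve ℚ) [W.IsElliptic] [W.IsGloballyMinimal] (p : ℕ) [Fact p.Prime],
      3 < p → W.HasGoodReductionAtPrime p → ¬ (p : ℤ) ∣ W.frobeniusTrace p →
      W.HasIrreducibleModPGaloisRep p →
      ∀ (K : Type) [Field K] [NumberField K], IsImaginaryQuadratic K →
        SatisfiesHeegnerHypothesis (W.conductorNorm ℤ) K →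
        Odd (NumberField.discr K) → NumberField.discr K ≠ -3 →
        AddSubgroup.torsionBy (W.baseChange K).toAffine.Point (p : ℤ) = ⊥ →
        SatisfiesHeegnerHypothesis p K →
        (W.baseChange K).selmerCorank p = 1 → analyticRankEK W K = 1) :
    yanZhu_analyticRank_eq_one_of_selmerCorank_eq_one := by
  intro W _ _ p _ hp5 hgood hord hsurj hcorank
  exact yanZhu_analyticRank_eq_one_of_selmerCorank_eq_one_of_bcgs_of_rootNumber_eq_neg_one hmod
    hHL (fun W _ p _ ↦ kato_finite_of_L_one_ne_zero_of_rank_eq_analyticRank W p hGZK) hBCGS W p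
    (by omega) hgood hord hsurj
    (rootNumber_eq_neg_one_of_selmerCorank_eq_one_of_facts hmod
      (waldspurger_exists_heegnerField_twist_ne_zero_of_hoffsteinLuo hmod hHL) hMM hGZK hDD W p
      (by omega) hcorank)
    hcorank

/-! ### What the fact carries unconditionally: the continuation of `L(E, s)` in its scope

In the tree's semantics `W.analyticRank` is the order at `s = 1` of `W.entireLFunction`, whose
documented junk value, when `L(W, s)` has no entire continuation, is the Dirichlet series
`W.LSeries` itself (`Literature.NumberTheory.EllipticCurves.AnalyticRank`). For an elliptic `W / ℚ`
that series diverges absolutely on `re s ≤ 1`, so in the junk branch `W.analyticRank = 0`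
(`WeierstrassCurve.analyticRank_eq_zero_of_not_hasEntireLFunction`,
`BSDRootNumberNoContinuationProofs`, unconditional). Consequently the conclusion
`ord_{s=1} L(E, s) = 1` of the Yan–Zhu fact already certifies the entire continuation of `L(E, s)`
for every curve in its scope, and the fact is *equivalent* to "continuation in scope" ∧ "its
restriction to curves with entire `L`-function": the continuation / modularity leaf (f) of the two
decompositions above is forced by the statement, not an artefact of the chosen route. -/

/-- **The Yan–Zhu fact certifies the entire continuation of `L(E, s)` in its scope.** If
`yanZhu_analyticRank_eq_one_of_selmerCorank_eq_one` holds then every elliptic curve over `ℚ`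
(globally minimal model `W`) admitting a prime `p ≥ 5` of good ordinary reduction with `ρ̄_{E,p}`
surjective and `corank_{ℤ_p} Sel_{p^∞}(E/ℚ) = 1` has an entire `L`-function
(`W.HasEntireLFunction`, the continuation half of the Hasse–Weil conjecture, Silverman AEC
Conj. C.16.1; over `ℚ` a consequence of the Modularity Theorem, tree facts
`WeierstrassCurve.hasEntireLFunction_rat` ⇐ `ModularForms.exists_isNewformOf`): the fact gives
`W.analyticRank = 1 ≠ 0`, and a positive analytic rank certifies the continuation
(`WeierstrassCurve.hasEntireLFunction_of_analyticRank_ne_zero`). [folklore] -/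
theorem hasEntireLFunction_of_yanZhu (h : yanZhu_analyticRank_eq_one_of_selmerCorank_eq_one)
    (W : WeierstrassCurve ℚ) [W.IsElliptic] [W.IsGloballyMinimal] (p : ℕ) [Fact p.Prime]
    (hp : 5 ≤ p) (hgood : W.HasGoodReductionAtPrime p) (hord : ¬ (p : ℤ) ∣ W.frobeniusTrace p)
    (hsurj : W.HasSurjectiveModNGaloisRep p) (hcorank : W.selmerCorank p = 1) :
    W.HasEntireLFunction :=
  W.hasEntireLFunction_of_analyticRank_ne_zero
    (by rw [h W p hp hgood hord hsurj hcorank]; exact one_ne_zero)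

/-- **The fact splits as "continuation in scope" ∧ "the `p`-converse for curves with entire
`L`-function".** `yanZhu_analyticRank_eq_one_of_selmerCorank_eq_one` is equivalent to the
conjunction of (i) `W.HasEntireLFunction` for every curve in its scope
(`hasEntireLFunction_of_yanZhu`) and (ii) its restriction to curves whose `L`-series has an entire
continuation. In the tree's semantics (ii) alone is strictly weaker — a corank-one curve in the
junk branch has `W.analyticRank = 0` — which is why every assembly of the fact in this file carries
a continuation / modularity leaf. [folklore] -/
theorem yanZhu_analyticRank_eq_one_of_selmerCorank_eq_one_iff_hasEntireLFunction_and :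
    yanZhu_analyticRank_eq_one_of_selmerCorank_eq_one ↔
      (∀ (W : WeierstrassCurve ℚ) [W.IsElliptic] [W.IsGloballyMinimal] (p : ℕ) [Fact p.Prime],
        5 ≤ p → W.HasGoodReductionAtPrime p → ¬ (p : ℤ) ∣ W.frobeniusTrace p →
        W.HasSurjectiveModNGaloisRep p → W.selmerCorank p = 1 → W.HasEntireLFunction) ∧
      (∀ (W : WeierstrassCurve ℚ) [W.IsElliptic] [W.IsGloballyMinimal] (p : ℕ) [Fact p.Prime],
        5 ≤ p → W.HasGoodReductionAtPrime p → ¬ (p : ℤ) ∣ W.frobeniusTrace p →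
        W.HasSurjectiveModNGaloisRep p → W.HasEntireLFunction → W.selmerCorank p = 1 →
        W.analyticRank = 1) := by
  constructor
  · intro h
    exact ⟨fun W _ _ p _ hp hgood hord hsurj hc ↦
        hasEntireLFunction_of_yanZhu h W p hp hgood hord hsurj hc,
      fun W _ _ p _ hp hgood hord hsurj _ hc ↦ h W p hp hgood hord hsurj hc⟩
  · rintro ⟨hE, hL⟩ W _ _ p _ hp hgood hord hsurj hc
    exact hL W p hp hgood hord hsurj (hE W p hp hgood hord hsurj hc) hc

end Literature.NumberTheory.EllipticCurves

end
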